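import Summits.Ventures.AbcSig.Rows.StatementsC1b
import Summits.Ventures.AbcSig.Rows.Xn64Yn15Z2QE

/-!
# Venture AbcSig — CELL bridge for `xⁿ + 2^α yⁿ = 15 z²` (FAMILY C1b, `α = 6`): p1's census predicate `Rows.C1bCell 15 (fun _ α => α = 6) 7 ∅`

Q-VARIANT (p-lean g6 `gen6/spatch2.py`) of `C1bCell_15_a6_of`: kernel sieve discharges (q = 2 rule, one extra named hypothesis hQ : M.Q2Package) replace the cited pair(s) 225.1 @ 7, 225.2 @ 7, 225.3 @ 7, 225.5 @ 7, 225.6 @ 11 (see the row file(s) `Rows/Xn64Yn15Z2Q.lean`).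
E-VARIANT (p-lean g6 `gen6/e3patch.py`) of `C1bCell_15_a6Q_of`: ERRATA E3 form — level 450 removed, hypothesis `hE3 : M.E3Package` added (see `Rows/Xn64Yn15Z2QE.lean`).
HONEST FRAMING. COMPUTATION cell `pub-abcsig`; CONDITIONAL theorem; no claim on ABC or any summit. Hypotheses exactly
those of `Rows/Xn64Yn15Z2X.lean` (`xrow_Xn64Yn15Z2`): `BS04Package` (CITED), `DataComplete` at the two levels (COMPUTED, certified level
files) and the row's per-orbit CITED exclusions `hX_…`, universally quantified in the exponent. Conclusion = the conjunct
`Rows.C1bCell 15 (fun _ α => α = 6) 7 ∅` of p1's `Rows.C1bSmallAlphaSigned` / `Rows.C1bExtSigned`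
(`Rows/StatementsC1b.lean`; row of record `census/rows/C1b/C1b-C15-a6.md`, R8-signed): every prime `n ≥ 7`, `n ∤ 15`,
`α = 6`, no primitive solution with `|xy| > 1`. GENERATED by p-lean gen3/make_c1bcell.py (pattern of `Rows/Xn8Yn11Z2Cell.lean`).
-/

namespace Summit.Ventures.AbcSig

/-- `xⁿ + 2^α yⁿ = 15z²` (`α = 6`), every prime `n ≥ 7` with `n ∤ 15`, `|xy| > 1`: p1's conjunct
`Rows.C1bCell 15 (fun _ α => α = 6) 7 ∅` from `xrow_Xn64Yn15Z2`. -/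
theorem C1bCell_15_a6QE_of (M : NewformModel) (hP : M.BS04Package) (hQ : M.Q2Package) (hE3 : M.E3Package)
    (hD225 : M.DataComplete 225 level225Orbits)
    (hQ2_orbit_225_1 : ∀ f : M.Form 225, M.Matches f orbit_225_1 → M.Matches f q2_225_1)
    (hQ2_orbit_225_2 : ∀ f : M.Form 225, M.Matches f orbit_225_2 → M.Matches f q2_225_2)
    (hQ2_orbit_225_3 : ∀ f : M.Form 225, M.Matches f orbit_225_3 → M.Matches f q2_225_3)
    (hX_orbit_225_4 : ∀ n : ℕ, M.Excludes 225 orbit_225_4 (famBC 6 15 n (fun _ b => ¬ 2 ∣ b)))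
    (hX_orbit_225_4e : ∀ n : ℕ, M.Excludes 225 orbit_225_4 (famBC 6 15 n (fun _ b => 2 ∣ b)))
    (hQ2_orbit_225_5 : ∀ f : M.Form 225, M.Matches f orbit_225_5 → M.Matches f q2_225_5)
    (hQ2_orbit_225_6 : ∀ f : M.Form 225, M.Matches f orbit_225_6 → M.Matches f q2_225_6) :
    Rows.C1bCell 15 (fun _ α => α = 6) 7 ∅ := by
  intro n hn h0 _ _ α hα x y z h1 h2
  subst hα
  exact xrow_Xn64Yn15Z2QE M hP hQ hE3 hD225 n hn h0 hQ2_orbit_225_1 hQ2_orbit_225_2 hQ2_orbit_225_3 (hX_orbit_225_4 n) (hX_orbit_225_4e n) hQ2_orbit_225_5 hQ2_orbit_225_6 x y z h1 h2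

end Summit.Ventures.AbcSig
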